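import Summits.RiemannHypothesis.RiemannHypothesis.Theorems.TiltedLandingLaw421R3Lens1ArcSignQ

/-!
# TiltedLandingLaw421R3 — lens-1 (part S): the NEAR CHILD — linearised child in the closed disc (by LINK START) and the Rouché certificate

LENS-1 gen-8 module image `rh33346-cover/lens-1/NearChild-v1.lean` (landing target `…/Theorems/TiltedLandingLaw421R3Lens1ArcSignS.lean`; ONE import =
part Q `…R3Lens1ArcSignQ`; namespace `RhW08.Lens1ArcSign`; 0 `sorry`; checked BY CHAIN over the tree part M with N, P, Q inlined).

WHAT C6ʼs LINK TRACE SHOWS (LINK-NOTE-C6-g39 8e94c616, 1 163 bank tops, 0 strangled tops): the link is ALWAYS realised by the NEAR CHILD — the zero `w` of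
`φ = G′/G` next to the pole `a`, `w ≈ a − 1/φ_reg(a)` with `φ_reg(a) = lim_{z→a} (φ(z) − 1/(z − a)) = G″(a)/(2G′(a))` (median offset .008·Im a), inside the CLOSED Jensen
disc on 1 163/1 163 rows with a thin margin (min .0056·Im a); first-order in-disc number `μ = −2·Im a·Im φ_reg(a) ≥ 3.00`.
§1 THE LINEARISED CHILD IS ALWAYS IN THE CLOSED DISC — and that is EXACTLY LINK START.  `linChild f j a := a − 2·f⁽ʲ⁺¹⁾(a)/f⁽ʲ⁺²⁾(a)` (= `a − 1/φ_reg(a)`, the zero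
of the linearisation `1/(z − a) + φ_reg(a)` of `φ`; twice the Newton step of `G′` at `a`).  Pure algebra (`nestedStep_sub_two_div_iff`): for `c ≠ 0`, `a − 2/c` lies in aʼs
closed Jensen disc ⟺ `Im c ≤ −1/Im a` ⟺ C6ʼs `μ ≥ 1`; and `Im(f⁽ʲ⁺²⁾(a)/f⁽ʲ⁺¹⁾(a)) ≤ −1/Im a` IS part Pʼs `LinkStartLawQ`, PROVED in part Q.  Hence ★★ `nestedStep_linChild`:
at every simple top with `NoTallerToucher` (real entire, order < 2) the linearised child lies in the CLOSED Jensen disc — on the circle iff `f⁽ʲ⁾` is the lone pair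
(`linChild_mem_openDisc` gives the open disc as soon as another zero exists); `deriv2_ne_zero_of_top`: such a top has `f⁽ʲ⁺²⁾(a) ≠ 0`; `linChild_im_lt`: the
linearised child is strictly LOWER than `a`.  (Over all real tilts `g` the linearised children `a − 1/(φ_reg + g)` fill the circle of diameter `[a − i/|Im φ_reg(a)|, a]`,
internally tangent to aʼs Jensen circle at `a` and inside it iff LINK START — the lone pair is the case of equality, whose children are ON the circle.)
§2 THE ROUCHÉ CERTIFICATE (pure complex analysis over the treeʼs exact-count Rouché theorem `Literature.Analysis.Complex.Rouche.existsUnique_zero_of_norm_sub_lt`):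
★★ `exists_crit_near_linChild`: `G` differentiable, `c ≠ 0`, `w₀ := a − 2/c`, `0 < r < ‖2/c‖`, `G ≠ 0` on the closed ball `B̄(w₀, r)`, and on the circle `‖z − w₀‖ = r`
the REGULAR-PART VARIATION is small — `‖(G′(z)/G(z) − (z − a)⁻¹ − c/2)·(z − a)‖ < (‖c‖/2)·r` — ⇒ `G′` has a zero `u` with `‖u − w₀‖ < r` (comparison function
`G·((z − a)⁻¹ + c/2) = G·c(z − w₀)/(2(z − a))`, whose only zero in the ball is `w₀`, simple).  ★★ `exists_nestedChild_of_roucheCert`: with `c := f⁽ʲ⁺²⁾(a)/f⁽ʲ⁺¹⁾(a)` and the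
ball inside aʼs closed disc above the axis (`‖w₀ − Re a‖ + r ≤ Im a`, `r < Im w₀`) the zero is a NON-REAL CHILD with `NestedStep a u` — disjunct 1 of `TopPinning`, row by row,
from ONE explicit inequality on ONE circle (exact/interval arithmetic).  ★ `RoucheCertLawQ` (OPEN, typed; binders of `TopLinkLawQ`): some radius certifies;
`topPinning_of_roucheCertLaw : RoucheCertLawQ → TopPinning`.  PARTIAL by nature — a price tag and a row-level instrument, like part Rʼs point certificate.  TOY
(`linktoy/rouchecert.py`, model `G = P·e^{gz}`, radius scan τ = r·‖c‖/2 ∈ [.02, .7], 11 tilts per frame): certified (frame, tilt) pairs AT 228/440 · N2 260/440 · N3 222/330 ·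
toothed 206/330, rising with the cluster strength `‖c‖·Im a` (< 4: 0 % · [4, 8): ≈ 30 % · ≥ 16: 85–100 %; C6ʼs bank: `‖c‖·Im a = 2|φ_reg(a)|·Im a` ∈ [4.4, 41.6], median 12.6),
0/916 violations (the true child is within `r` of `w₀` every time); complementary to part R (point certificate: AT 40/60 but N3 8/40 — Rouché is best on N3).
NOT claimed: `RoucheCertLawQ`, `PointCertLawQ`, `TopLinkLawQ`, `TopPinning`.  Nothing here bears on the truth of RH; RH is not proved; 33346/33347 OPEN.
-/

noncomputable section

namespace RhW08.Lens1ArcSign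

open Complex Set Metric Filter Topology
open scoped Real ComplexConjugate
open Literature.Topology.PlaneTopology Literature.Analysis.Complex
open Summit.RiemannHypothesis.RiemannHypothesis.Theorems.Splittings.JensenWindow
open RhIdea6.G17.W07C7 RhIdea6.G17.W07C7.Rev6 RhIdea6.G18.W07C8.Law421BirthS RhIdea6.G19.W07C11.Seam
open RhIdea6.G20.W07C12.Frac RhIdea6.G20.W07C12.StColP RhW07.C12.FieldSplit RhIdea6.G21.W07C13.TentMax
open RhW07.C14.TwoSided RhW07.C14.Classes RhW07.C14.Lineage RhW07.C14.Booking
open RhW07.C13.Heredity RhIdea6.G22.W07C15pre.Injection RhW07.E3.Cell RhW07.E3.Lit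
open RhW08.Round1 RhW08.StSwap RhW08.Round2 RhW08.QuadW RhW08.SealSwapQ RhW08.SealSwap RhW08.SuccB RhW08.SuccSplit
open RhW08.SuccTheft RhW08.Column RhW08.Hurwitz RhW08.ClusterQ RhW08.ClusterQM RhW08.NewtonDoor RhW08.NewtonDoorGenusOne RhW08.PurseP
open RhW08.Lens1SignCut RhW08.Lens1Coverage RhW08.IsolatedTilt RhW08.Lens1Pinning RhW08.Lens1PinningIso


/-! ## §1 the linearised child and LINK START -/

/-- Pure algebra: for `c ≠ 0`, the point `a − 2/c` lies in aʼs CLOSED Jensen disc iff `Im a · Im c ≤ −1`. -/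
theorem nestedStep_sub_two_div_iff {a c : ℂ} (hc : c ≠ 0) : NestedStep a (a - 2 / c) ↔ a.im * c.im ≤ -1 := by
  have hn : 0 < Complex.normSq c := Complex.normSq_pos.2 hc
  have hnq : Complex.normSq c = c.re * c.re + c.im * c.im := Complex.normSq_apply c
  have hre : (a - 2 / c).re - a.re = -(2 * c.re / Complex.normSq c) := by
    rw [Complex.sub_re, Complex.div_re]; simp
  have him : (a - 2 / c).im = a.im + 2 * c.im / Complex.normSq c := by
    rw [Complex.sub_im, Complex.div_im]; simp
  unfold NestedStep
  rw [hre, him]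
  have key : (-(2 * c.re / Complex.normSq c)) ^ 2 + (a.im + 2 * c.im / Complex.normSq c) ^ 2 - a.im ^ 2 =
      4 / Complex.normSq c * (1 + a.im * c.im) := by
    field_simp
    rw [hnq]; ring
  constructor
  · intro h
    have h4 : 4 / Complex.normSq c * (1 + a.im * c.im) ≤ 0 := by rw [← key]; linarith
    have hpos : 0 < 4 / Complex.normSq c := by positivity
    rcases le_or_gt (a.im * c.im) (-1) with h' | h'
    · exact h'
    · have := mul_pos hpos (by linarith : 0 < 1 + a.im * c.im)
      linarith
  · intro h
    have h4 : 4 / Complex.normSq c * (1 + a.im * c.im) ≤ 0 :=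
      mul_nonpos_of_nonneg_of_nonpos (by positivity) (by linarith)
    rw [← key] at h4; linarith

/-- … in particular `Im c ≤ −1/Im a` (the shape of `LinkStartLawQ`ʼs conclusion) puts `a − 2/c` in the closed disc. -/
theorem nestedStep_sub_two_div {a c : ℂ} (ha : 0 < a.im) (hc : c.im ≤ -1 / a.im) : NestedStep a (a - 2 / c) := by
  have hcim : c.im < 0 := lt_of_le_of_lt hc (by rw [neg_div]; exact neg_neg_of_pos (one_div_pos.2 ha))
  have hc0 : c ≠ 0 := fun h => by rw [h, Complex.zero_im] at hcim; exact lt_irrefl _ hcim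
  rw [nestedStep_sub_two_div_iff hc0]
  have := (le_div_iff₀ ha).1 hc
  linarith [this]

/-- Strict version: `Im c < −1/Im a` puts `a − 2/c` in the OPEN disc. -/
theorem mem_openDisc_sub_two_div {a c : ℂ} (ha : 0 < a.im) (hc : c.im < -1 / a.im) :
    ((a - 2 / c).re - a.re) ^ 2 + (a - 2 / c).im ^ 2 < a.im ^ 2 := by
  have hcim : c.im < 0 := lt_trans hc (by rw [neg_div]; exact neg_neg_of_pos (one_div_pos.2 ha))
  have hc0 : c ≠ 0 := fun h => by rw [h, Complex.zero_im] at hcim; exact lt_irrefl _ hcim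
  have hn : 0 < Complex.normSq c := Complex.normSq_pos.2 hc0
  have hnq : Complex.normSq c = c.re * c.re + c.im * c.im := Complex.normSq_apply c
  have hre : (a - 2 / c).re - a.re = -(2 * c.re / Complex.normSq c) := by
    rw [Complex.sub_re, Complex.div_re]; simp
  have him : (a - 2 / c).im = a.im + 2 * c.im / Complex.normSq c := by
    rw [Complex.sub_im, Complex.div_im]; simp
  rw [hre, him]
  have key : (-(2 * c.re / Complex.normSq c)) ^ 2 + (a.im + 2 * c.im / Complex.normSq c) ^ 2 - a.im ^ 2 =
      4 / Complex.normSq c * (1 + a.im * c.im) := by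
    field_simp
    rw [hnq]; ring
  have hlt : a.im * c.im < -1 := by have := (lt_div_iff₀ ha).1 hc; linarith
  have h4 : 4 / Complex.normSq c * (1 + a.im * c.im) < 0 := mul_neg_of_pos_of_neg (by positivity) (by linarith)
  rw [← key] at h4; linarith

/-- The LINEARISED CHILD of a zero `a` of `f^{(j)}`: `a − 2·f^{(j+1)}(a)/f^{(j+2)}(a) = a − 1/φ_reg(a)`, the zero of the linearisation `1/(z − a) + φ_reg(a)` of
`φ = f^{(j+1)}/f^{(j)}` at its pole `a` (C6ʼs `a − 1/φ_reg(a)`; twice the Newton step of `f^{(j+1)}` at `a`). -/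
def linChild (f : ℂ → ℂ) (j : ℕ) (a : ℂ) : ℂ := a - 2 * iteratedDeriv (j + 1) f a / iteratedDeriv (j + 2) f a

/-- A simple top with `NoTallerToucher` has `f^{(j+2)}(a) ≠ 0` (since `Im(f^{(j+2)}(a)/f^{(j+1)}(a)) ≤ −1/Im a < 0`). -/
theorem deriv2_ne_zero_of_top {f : ℂ → ℂ} (hf : RealEntireLt2 f) (j : ℕ) {a : ℂ} (ha : iteratedDeriv j f a = 0) (hapos : 0 < a.im)
    (hN : NoTallerToucher f j a) (hsimp : iteratedDeriv (j + 1) f a ≠ 0) : iteratedDeriv (j + 2) f a ≠ 0 := by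
  intro h0
  have h := linkStart_of_realEntireLt2 hf j ha hapos hN hsimp
  rw [h0, zero_div, Complex.zero_im] at h
  have : 0 < 1 / a.im := one_div_pos.2 hapos
  rw [neg_div] at h; linarith

/-- `linChild = a − 2/c` with `c = f^{(j+2)}(a)/f^{(j+1)}(a)`. -/
theorem linChild_eq {f : ℂ → ℂ} (j : ℕ) {a : ℂ} (hsimp : iteratedDeriv (j + 1) f a ≠ 0) (h2 : iteratedDeriv (j + 2) f a ≠ 0) :
    linChild f j a = a - 2 / (iteratedDeriv (j + 2) f a / iteratedDeriv (j + 1) f a) := by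
  unfold linChild
  congr 1
  field_simp

/-- ★★ THE LINEARISED CHILD IS IN THE CLOSED JENSEN DISC at every simple top with `NoTallerToucher` (real entire, order `< 2`) — by LINK START (part Q). -/
theorem nestedStep_linChild {f : ℂ → ℂ} (hf : RealEntireLt2 f) (j : ℕ) {a : ℂ} (ha : iteratedDeriv j f a = 0) (hapos : 0 < a.im)
    (hN : NoTallerToucher f j a) (hsimp : iteratedDeriv (j + 1) f a ≠ 0) : NestedStep a (linChild f j a) := by
  rw [linChild_eq j hsimp (deriv2_ne_zero_of_top hf j ha hapos hN hsimp)]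
  exact nestedStep_sub_two_div hapos (linkStart_of_realEntireLt2 hf j ha hapos hN hsimp)

/-- … and in the OPEN disc as soon as `f^{(j)}` has a zero other than `a, ā`. -/
theorem linChild_mem_openDisc {f : ℂ → ℂ} (hf : RealEntireLt2 f) (j : ℕ) {a : ℂ} (ha : iteratedDeriv j f a = 0) (hapos : 0 < a.im)
    (hN : NoTallerToucher f j a) (hsimp : iteratedDeriv (j + 1) f a ≠ 0) (hex : ∃ z, iteratedDeriv j f z = 0 ∧ z ≠ a ∧ z ≠ conj a) :
    ((linChild f j a).re - a.re) ^ 2 + (linChild f j a).im ^ 2 < a.im ^ 2 := by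
  rw [linChild_eq j hsimp (deriv2_ne_zero_of_top hf j ha hapos hN hsimp)]
  exact mem_openDisc_sub_two_div hapos (linkStart_strict_of_realEntireLt2 hf j ha hapos hN hsimp hex)

/-- The linearised child is strictly LOWER than `a`: `Im(a − 2/c) < Im a` whenever `Im c < 0`. -/
theorem im_sub_two_div_lt {a c : ℂ} (hc : c.im < 0) : (a - 2 / c).im < a.im := by
  have hc0 : c ≠ 0 := fun h => by rw [h, Complex.zero_im] at hc; exact lt_irrefl _ hc
  have hn : 0 < Complex.normSq c := Complex.normSq_pos.2 hc0
  have him : (a - 2 / c).im = a.im + 2 * c.im / Complex.normSq c := by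
    rw [Complex.sub_im, Complex.div_im]; simp
  rw [him]
  have : 2 * c.im / Complex.normSq c < 0 := div_neg_of_neg_of_pos (by linarith) hn
  linarith

/-- … at a simple top with `NoTallerToucher`: `Im (linChild f j a) < Im a`. -/
theorem linChild_im_lt {f : ℂ → ℂ} (hf : RealEntireLt2 f) (j : ℕ) {a : ℂ} (ha : iteratedDeriv j f a = 0) (hapos : 0 < a.im)
    (hN : NoTallerToucher f j a) (hsimp : iteratedDeriv (j + 1) f a ≠ 0) : (linChild f j a).im < a.im := by
  rw [linChild_eq j hsimp (deriv2_ne_zero_of_top hf j ha hapos hN hsimp)]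
  refine im_sub_two_div_lt (lt_of_le_of_lt (linkStart_of_realEntireLt2 hf j ha hapos hN hsimp) ?_)
  rw [neg_div]; exact neg_neg_of_pos (one_div_pos.2 hapos)

/-! ## §2 the Rouché certificate for the near child -/

/-- The comparison function's factor: `(z − a)⁻¹ + c/2 = c·(z − (a − 2/c))/(2(z − a))` for `z ≠ a`, `c ≠ 0`. -/
theorem inv_add_half_eq {a c z : ℂ} (hc : c ≠ 0) (hz : z ≠ a) : (z - a)⁻¹ + c / 2 = c * (z - (a - 2 / c)) / (2 * (z - a)) := by
  have hza : z - a ≠ 0 := sub_ne_zero.2 hz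
  field_simp
  ring

/-- ★★ ROUCHÉ FOR THE NEAR CHILD: `G` differentiable, `c ≠ 0`, `w₀ = a − 2/c`, `0 < r < ‖2/c‖` (so `a` is outside the closed ball `B̄(w₀, r)`), `G ≠ 0` on that closed ball,
and on the circle `‖z − w₀‖ = r` the regular-part variation is small: `‖(G′ z/G z − (z − a)⁻¹ − c/2)·(z − a)‖ < (‖c‖/2)·r` ⇒ `G′` has a zero `u` with `‖u − w₀‖ < r`. -/
theorem exists_crit_near_linChild {G : ℂ → ℂ} (hG : Differentiable ℂ G) {a c : ℂ} (hc : c ≠ 0) {r : ℝ} (hr : 0 < r) (hr2 : r < ‖2 / c‖)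
    (hG0 : ∀ z, ‖z - (a - 2 / c)‖ ≤ r → G z ≠ 0)
    (hsmall : ∀ z, ‖z - (a - 2 / c)‖ = r → ‖(deriv G z / G z - (z - a)⁻¹ - c / 2) * (z - a)‖ < ‖c‖ / 2 * r) :
    ∃ u : ℂ, ‖u - (a - 2 / c)‖ < r ∧ deriv G u = 0 := by
  set w₀ : ℂ := a - 2 / c with hw₀
  -- `a` is not in the open ball `ball w₀ ‖2/c‖`
  have haw : ‖a - w₀‖ = ‖2 / c‖ := by rw [hw₀, sub_sub_cancel]
  have hne_a : ∀ z ∈ ball w₀ ‖2 / c‖, z ≠ a := by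
    intro z hz hza
    rw [mem_ball, dist_eq_norm, hza, haw] at hz
    exact lt_irrefl _ hz
  set g : ℂ → ℂ := fun z => G z * ((z - a)⁻¹ + c / 2) with hg
  have hginv : DifferentiableOn ℂ (fun z : ℂ => (z - a)⁻¹ + c / 2) (ball w₀ ‖2 / c‖) := by
    intro z hz
    have hza : z - a ≠ 0 := sub_ne_zero.2 (hne_a z hz)
    exact (((differentiableAt_id.sub_const a).inv hza).add_const (c / 2)).differentiableWithinAt
  have hgd : DifferentiableOn ℂ g (ball w₀ ‖2 / c‖) := (hG.differentiableOn).mul hginv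
  have hfd : DifferentiableOn ℂ (deriv G) (ball w₀ ‖2 / c‖) := (differentiable_deriv hG).differentiableOn
  -- Rouché inequality on the circle
  have hR : ∀ z : ℂ, ‖z - w₀‖ = r → ‖deriv G z - g z‖ < ‖g z‖ := by
    intro z hz
    have hzball : z ∈ ball w₀ ‖2 / c‖ := by rw [mem_ball, dist_eq_norm, hz]; exact hr2
    have hza : z ≠ a := hne_a z hzball
    have hza' : z - a ≠ 0 := sub_ne_zero.2 hza
    have hGz : G z ≠ 0 := hG0 z hz.le
    have hfac : (z - a)⁻¹ + c / 2 = c * (z - w₀) / (2 * (z - a)) := by rw [hw₀]; exact inv_add_half_eq hc hza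
    have hnormq : ‖(z - a)⁻¹ + c / 2‖ = ‖c‖ / 2 * r / ‖z - a‖ := by
      rw [hfac, norm_div, norm_mul, norm_mul, hz, Complex.norm_two]; ring
    have hgz : g z = G z * ((z - a)⁻¹ + c / 2) := rfl
    have h1 : deriv G z - g z = G z * ((deriv G z / G z - (z - a)⁻¹ - c / 2) * (z - a)) / (z - a) := by
      rw [hgz]; field_simp; ring
    rw [h1, norm_div, norm_mul (G z) ((deriv G z / G z - (z - a)⁻¹ - c / 2) * (z - a)), hgz,
      norm_mul (G z) ((z - a)⁻¹ + c / 2), hnormq]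
    have hGpos : 0 < ‖G z‖ := norm_pos_iff.2 hGz
    have hzapos : 0 < ‖z - a‖ := norm_pos_iff.2 hza'
    rw [div_lt_iff₀ hzapos, show ‖G z‖ * (‖c‖ / 2 * r / ‖z - a‖) * ‖z - a‖ = ‖G z‖ * (‖c‖ / 2 * r) by field_simp]
    exact mul_lt_mul_of_pos_left (hsmall z hz) hGpos
  -- the comparison function has the unique simple zero w₀ in the closed ball
  have hw₀mem : w₀ ∈ closedBall w₀ r := mem_closedBall_self hr.le
  have hw₀a : w₀ ≠ a := hne_a w₀ (mem_ball_self (lt_trans hr hr2))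
  have hw₀a' : w₀ - a ≠ 0 := sub_ne_zero.2 hw₀a
  have hq0 : (w₀ - a)⁻¹ + c / 2 = 0 := by
    rw [hw₀]
    have : a - 2 / c - a = -(2 / c) := by ring
    rw [this, inv_neg, inv_div]; ring
  have hg0 : g w₀ = 0 := by show G w₀ * ((w₀ - a)⁻¹ + c / 2) = 0; rw [hq0, mul_zero]
  have hGw₀ : G w₀ ≠ 0 := hG0 w₀ (by rw [sub_self, norm_zero]; exact hr.le)
  have hg1 : deriv g w₀ ≠ 0 := by
    have hqd : HasDerivAt (fun z : ℂ => (z - a)⁻¹ + c / 2) (-1 / (w₀ - a) ^ 2) w₀ := by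
      have h := ((hasDerivAt_id w₀).sub_const a).inv hw₀a'
      simpa using h.add_const (c / 2)
    have hprod := (hG w₀).hasDerivAt.mul hqd
    have hderiv : deriv g w₀ = deriv G w₀ * ((w₀ - a)⁻¹ + c / 2) + G w₀ * (-1 / (w₀ - a) ^ 2) := hprod.deriv
    rw [hderiv, hq0, mul_zero, zero_add]
    exact mul_ne_zero hGw₀ (div_ne_zero (neg_ne_zero.2 one_ne_zero) (pow_ne_zero 2 hw₀a'))
  have huniq : ∀ v ∈ closedBall w₀ r, g v = 0 → v = w₀ := by
    intro v hv hgv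
    have hvball : v ∈ ball w₀ ‖2 / c‖ := by
      rw [mem_ball]; rw [mem_closedBall] at hv; exact lt_of_le_of_lt hv hr2
    have hva : v ≠ a := hne_a v hvball
    have hGv : G v ≠ 0 := hG0 v (by rw [← dist_eq_norm]; exact hv)
    have hq : (v - a)⁻¹ + c / 2 = 0 := by
      rcases mul_eq_zero.1 hgv with h | h
      · exact (hGv h).elim
      · exact h
    rw [inv_add_half_eq hc hva, div_eq_zero_iff] at hq
    rcases hq with h | h
    · rcases mul_eq_zero.1 h with h' | h'
      · exact (hc h').elim
      · rw [hw₀]; exact sub_eq_zero.1 h'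
    · exact (mul_ne_zero two_ne_zero (sub_ne_zero.2 hva) h).elim
  obtain ⟨u, hu, hu0, -, -⟩ :=
    Literature.Analysis.Complex.Rouche.existsUnique_zero_of_norm_sub_lt hr hr2 hfd hgd hR hw₀mem hg0 hg1 huniq
  exact ⟨u, hu, hu0⟩

/-- Geometry of the certificate ball: `‖u − w₀‖ < r`, `‖w₀ − Re a‖ + r ≤ Im a`, `r < Im w₀` ⇒ `u` is an upper point of aʼs closed Jensen disc. -/
theorem nestedStep_of_near {a w₀ u : ℂ} {r : ℝ} (hu : ‖u - w₀‖ < r) (hball : ‖w₀ - (a.re : ℂ)‖ + r ≤ a.im) (hup : r < w₀.im) :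
    NestedStep a u ∧ 0 < u.im := by
  have h1 : ‖u - (a.re : ℂ)‖ ≤ ‖u - w₀‖ + ‖w₀ - (a.re : ℂ)‖ := norm_sub_le_norm_sub_add_norm_sub _ _ _
  have h2 : ‖u - (a.re : ℂ)‖ ≤ |a.im| := by
    calc ‖u - (a.re : ℂ)‖ ≤ ‖u - w₀‖ + ‖w₀ - (a.re : ℂ)‖ := h1
      _ ≤ a.im := by linarith
      _ ≤ |a.im| := le_abs_self _
  have h3 : |(u - w₀).im| ≤ ‖u - w₀‖ := Complex.abs_im_le_norm _
  rw [Complex.sub_im, abs_le] at h3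
  exact ⟨(norm_sub_re_le_iff u a).1 h2, by linarith [h3.1]⟩

/-- The ROUCHÉ CERTIFICATE of a zero `a` of `f^{(j)}` at radius `r` (row-level, explicit): with `c := f^{(j+2)}(a)/f^{(j+1)}(a)` and `w₀ := a − 2/c` —
`0 < r < ‖2/c‖`, the ball `B̄(w₀, r)` lies in aʼs closed disc above the axis, `f^{(j)} ≠ 0` on it, and the regular-part variation of `f^{(j+1)}/f^{(j)}` on its
boundary circle is `< (‖c‖/2)·r`. -/
def RoucheCert (f : ℂ → ℂ) (j : ℕ) (a : ℂ) (r : ℝ) : Prop :=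
  let c := iteratedDeriv (j + 2) f a / iteratedDeriv (j + 1) f a
  0 < r ∧ r < ‖2 / c‖ ∧ ‖(a - 2 / c) - (a.re : ℂ)‖ + r ≤ a.im ∧ r < (a - 2 / c).im ∧
    (∀ z, ‖z - (a - 2 / c)‖ ≤ r → iteratedDeriv j f z ≠ 0) ∧
    ∀ z, ‖z - (a - 2 / c)‖ = r →
      ‖(iteratedDeriv (j + 1) f z / iteratedDeriv j f z - (z - a)⁻¹ - c / 2) * (z - a)‖ < ‖c‖ / 2 * r

/-- ★★ ROUCHÉ CERTIFICATE ⇒ NESTED CHILD: a certified radius produces a non-real zero of `f^{(j+1)}` in aʼs closed Jensen disc, within `r` of the linearised child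
(any differentiable `f`; `c ≠ 0` is part of the data through `r < ‖2/c‖`). -/
theorem exists_nestedChild_of_roucheCert {f : ℂ → ℂ} {j : ℕ} (hf : Differentiable ℂ (iteratedDeriv j f)) {a : ℂ} {r : ℝ}
    (hc : iteratedDeriv (j + 2) f a / iteratedDeriv (j + 1) f a ≠ 0) (hR : RoucheCert f j a r) :
    ∃ u : ℂ, iteratedDeriv (j + 1) f u = 0 ∧ u.im ≠ 0 ∧ NestedStep a u ∧
      ‖u - (a - 2 / (iteratedDeriv (j + 2) f a / iteratedDeriv (j + 1) f a))‖ < r := by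
  obtain ⟨hr, hr2, hball, hup, hG0, hsmall⟩ := hR
  have hsucc : iteratedDeriv (j + 1) f = deriv (iteratedDeriv j f) := iteratedDeriv_succ
  have hsmall' : ∀ z, ‖z - (a - 2 / (iteratedDeriv (j + 2) f a / iteratedDeriv (j + 1) f a))‖ = r →
      ‖(deriv (iteratedDeriv j f) z / iteratedDeriv j f z - (z - a)⁻¹ - iteratedDeriv (j + 2) f a / iteratedDeriv (j + 1) f a / 2) * (z - a)‖ <
        ‖iteratedDeriv (j + 2) f a / iteratedDeriv (j + 1) f a‖ / 2 * r := by
    intro z hz; rw [← hsucc]; exact hsmall z hz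
  obtain ⟨u, hu, hu0⟩ := exists_crit_near_linChild hf hc hr hr2 hG0 hsmall'
  obtain ⟨hN, hupos⟩ := nestedStep_of_near hu hball hup
  exact ⟨u, by rw [hsucc]; exact hu0, hupos.ne', hN, hu⟩

/-- ★ THE ROUCHÉ-CERTIFICATE LAW (OPEN, typed; binders of `TopLinkLawQ`): every simple crossing top admits a certified radius.  PARTIAL by nature (C6: isolation ratio
ρ > .5 on 9/1 163 bank rows) — a price tag; the row-level use is `exists_nestedChild_of_roucheCert`. -/
def RoucheCertLawQ : Prop :=
  ∀ (η : ℝ) (f : ℂ → ℂ) (x₀ s hmax R Hs : ℝ) (B : ℕ), EngineHyps5 2 η f x₀ s hmax R Hs B → ∀ (j : ℕ) (a : ℂ),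
    iteratedDeriv j f a = 0 → 0 < a.im → NoTallerToucher f j a → ¬ JensenIsolated f j a → iteratedDeriv (j + 1) f a ≠ 0 → ∃ r : ℝ, RoucheCert f j a r

/-- ★★ `RoucheCertLawQ ⟹ TopPinningCrossing` (a multiple `a` is its own child; `c ≠ 0` by `deriv2_ne_zero_of_top`). -/
theorem topPinningCrossing_of_roucheCertLaw (hL : RoucheCertLawQ) : TopPinningCrossing := by
  intro η f x₀ s hmax R Hs B hE j a ha hapos hN hJ
  by_cases hda : iteratedDeriv (j + 1) f a = 0
  · exact Or.inl ⟨a, hda, hapos.ne', by show (a.re - a.re) ^ 2 + a.im ^ 2 ≤ a.im ^ 2; simp⟩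
  have hf : RealEntireLt2 f := realEntireLt2_of_hyps hE
  obtain ⟨r, hR⟩ := hL η f x₀ s hmax R Hs B hE j a ha hapos hN hJ hda
  have hc : iteratedDeriv (j + 2) f a / iteratedDeriv (j + 1) f a ≠ 0 :=
    div_ne_zero (deriv2_ne_zero_of_top hf j ha hapos hN hda) hda
  obtain ⟨u, hu, hui, hNu, -⟩ :=
    exists_nestedChild_of_roucheCert (RhW08.WindowLoss.realEntireLt2_iteratedDeriv hf j).diff hc hR
  exact Or.inl ⟨u, hu, hui, hNu⟩

/-- ★★ … hence `RoucheCertLawQ ⟹ TopPinning`. -/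
theorem topPinning_of_roucheCertLaw (hL : RoucheCertLawQ) : TopPinning :=
  topPinning_of_crossing (topPinningCrossing_of_roucheCertLaw hL)

end RhW08.Lens1ArcSign
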